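import Literature.NumberTheory.NumberFields.CMFieldAmbiguousClassNumber
import Literature.NumberTheory.NumberFields.QuarticCMFieldNonNormal
import Literature.NumberTheory.NumberFields.ClassGroupNormSurjective
import Literature.NumberTheory.QuadraticFields.RealQuadraticOddNarrowClassNumber
import HarnessLib

/-!
# A non-normal quartic CM field with odd relative class number: one ramified prime, `h⁺(K⁺)` odd, `h(K)` odd,
# and conversely (Louboutin–Okazaki, *Acta Arith.* 67 (1994), §2 (3)–(4), (8)) — without class field theory

Topic `NumberTheory/NumberFields`; namespace `Literature.NumberTheory.NumberFields`.  Theorem-only file (no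
definition, no named fact, no `sorry`), unconditional.  Junction of `QuarticCMFieldNonNormal.lean` (§2 (1)–(2):
a non-normal quartic CM field is primary, `κ_K = 1`), `CMFieldAmbiguousClassNumber.lean` (Chevalley's formula
for `K/K⁺`: Louboutin–Okazaki's Prop. 2 `t ≥ 2 ⇒ h⁻ even`, Horie's Lemma 1 (ii)) and
`CMFieldClassGroupTwoRank.lean` (Washington's Prop. 10.12 `#Cl_{K⁺}[2] ∣ κ_K · #A_K[2]`).

> Louboutin–Okazaki, §2: "From now on, we assume that `K` has odd relative class number `h*(K)`.  By
> [W, Th. 10.2], the class number `h(K⁺)` of the real quadratic subfield `K⁺` of `K` is odd.  We now prove a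
> little bit more: **(3)** The strict class number `h⁺(K⁺)` of `K⁺` is odd.  Thus `K⁺ = ℚ(√p)` with
> `p ≢ 3 (mod 4)` a prime. […] **(4)** There is exactly one prime ideal `Q⁺` of `K⁺` that ramifies in `K/K⁺`."
> […] **(8)** "If `K_{(p,q)}` is a CM-field then `h*(K_{(p,q)})` is odd.  *Proof.* … Now, let `C` be an ideal class
> of order `≤ 2` in the ideal class group of `K`.  Since `N_{K/K⁺}(C)` has order `≤ 2` in the ideal class group of
> `K⁺` that has odd order, it follows that `N_{K/K⁺}(C)` is principal, so that `C C̄ = i_{K/K⁺}(N_{K/K⁺}(C))` is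
> principal, and thus `C̄ = C`, i.e. `C` is an ambiguous class. […] the order of `C` is odd, i.e. `C` is the
> principal ideal class.  Hence, there does not exist an ideal class of order `2`, so that `h(K)` is odd."
> **Theorem 4.** "A number field is a non-normal quartic CM-field with odd relative class number if and only if it
> is a subfield of a dihedral octic CM-field `N(p,q)` that is a cyclic quartic extension of the real quadratic field
> `ℚ(√pq)`, unramified at the finite places, such that `4` does not divide the class number of `ℚ(√pq)`, where `p`
> and `q` are distinct primes not congruent to `3 (mod 4)` and `q` splits in `ℚ(√p)`."

Louboutin–Okazaki prove (3) by class field theory (the class field of `H⁺(K⁺)²`); here it is read off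
Chevalley's ambiguous class number formula: for a non-normal quartic CM field `K` with `h⁻_K` odd,

1. `t = 1` — at most one finite prime of `K⁺` ramifies (`t ≥ 2 ⇒ h⁻` even, Prop. 2) and at least one does
   (§2 (1)): `IsCMField.card_ramified_eq_one_of_not_isGalois_of_odd` ((4), first statement);
2. `h(K⁺)` is odd — `#Cl_{K⁺}[2] ∣ κ_K · #A_K[2] = 1 · 1`:
   `IsCMField.odd_classNumber_maximalRealSubfield_of_not_isGalois_of_odd`; hence `h(K) = h⁻ h(K⁺)` is odd
   (`IsCMField.odd_classNumber_of_not_isGalois_of_odd`) and `#Cl_K[2] = 1`;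
3. Horie's Lemma 1 (ii) at `t = 1` gives `#Cl_K[2] = #(E⁺_{K⁺}/E²_{K⁺}) = h⁺(K⁺)/h(K⁺)`, so **every totally
   positive unit of `K⁺` is a square, `h⁺(K⁺) = h(K⁺)`, and `h⁺(K⁺)` is odd** ((3), first sentence:
   `IsCMField.card_totPosUnitsModSq_eq_one_of_not_isGalois_of_odd`,
   `IsCMField.narrowClassNumber_eq_classNumber_of_not_isGalois_of_odd`,
   **`IsCMField.odd_narrowClassNumber_of_not_isGalois_of_odd`**).

4. **(3), second sentence «Thus `K⁺ = ℚ(√p)` with `p ≢ 3 (mod 4)` a prime»**: genus theory of real quadratic fields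
   (`QuadraticFields/RealQuadraticOddNarrowClassNumber.lean`: `h⁺` odd ⟺ one ramified prime ⟺ `d = 8` or
   `d = p ≡ 1 (mod 4)`) applied to `K⁺`: `IsCMField.discr_maximalRealSubfield_eq_of_not_isGalois_of_odd`,
   **`IsCMField.exists_prime_sq_eq_of_not_isGalois_of_odd`** (`K⁺ ∋ x ∉ ℚ` with `x² = p`, `p = 2` or `p ≡ 1 (mod 4)`).

5. **The converse, intrinsic form of (8) and Theorem 4**: for every CM field, `h_K` odd ⟹ `h⁻_K` odd
   (`IsCMField.odd_classNumber_div_of_odd_classNumber`), and `h⁺(K⁺)` odd with `t = 1` ⟹ `h_K`, `h⁻_K` odd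
   (`IsCMField.odd_classNumber_div_of_odd_narrowClassNumber_of_ncard_eq_one`; Chevalley: `rank₂ C_K = t − 1`, the
   mechanism of the proof of (8)); hence for a non-normal quartic CM field **`h⁻_K` odd ⟺ `h_K` odd ⟺ (`h⁺(K⁺)` odd
   and exactly one finite prime of `K⁺` ramifies in `K`)** (`IsCMField.odd_classNumber_div_iff_odd_classNumber_of_not_isGalois`,
   **`IsCMField.odd_classNumber_div_iff_of_not_isGalois`**, `IsCMField.odd_classNumber_div_iff_exists_unique_of_not_isGalois`).

NOT here: the generator `δ⁺` with `(δ⁺) = Q⁺^{h(K⁺)}` of (4), and (5) (both in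
`QuarticCMFieldOddRelativeClassNumberRamifiedPrime.lean`); (6)–(7) and Theorem 4 as printed (the dihedral octic CM fields
`N(p,q)`, class field theory over `ℚ(√pq)`).

## References

* S. Louboutin, R. Okazaki, *Determination of all non-normal quartic CM-fields and of all non-abelian normal
  octic CM-fields with class number one*, Acta Arith. 67 (1994) 47–62, §2 (3)–(4) (held
  `paper:doi-10-4064-aa-67-1-47-62`, p. 52), (8) and Theorem 4 (p. 55). [LouboutinOkazaki1994]
* R. Okazaki, *Inclusion of CM-fields and divisibility of relative class numbers*, Acta Arith. 92 (2000), §3 Lemma 17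
  (tree `CMFieldAmbiguousClassNumber.lean`). [Okazaki2000]
* K. Horie, *On CM-fields with the same maximal real subfield*, Acta Arith. 67 (1994), §1 Lemma 1. [Horie1994]
* L. C. Washington, *Introduction to Cyclotomic Fields*, 2nd ed. (1997), Thm. 10.2, Prop. 10.12. [Washington1997]
-/

noncomputable section

open NumberField NumberField.IsCMField NumberField.Units IsDedekindDomain
open Module (finrank)

namespace Literature.NumberTheory.NumberFields

open Literature.Geometry.Kaehler Literature.Geometry.Kaehler.ComplexTorus

variable (K : Type) [Field K] [NumberField K] [IsCMField K]

/-- `#G[2] = 1` iff `#G` is odd, for a finite commutative group `G` (Cauchy; as in `CMFieldAmbiguousClassNumber.lean`).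
[folklore] -/
private theorem card_twoTorsion_eq_one_iff_odd_card' {G : Type*} [CommGroup G] [Finite G] :
    Nat.card {g : G // g ^ 2 = 1} = 1 ↔ Odd (Nat.card G) := by
  classical
  haveI := Fintype.ofFinite G
  constructor
  · intro h1
    by_contra hodd
    rw [Nat.not_odd_iff_even, even_iff_two_dvd, Nat.card_eq_fintype_card] at hodd
    obtain ⟨g, hg⟩ := exists_prime_orderOf_dvd_card 2 hodd
    have hg2 : g ^ 2 = 1 := by rw [← hg]; exact pow_orderOf_eq_one g
    have hg1 : g ≠ 1 := by
      intro h; rw [h, orderOf_one] at hg; exact absurd hg (by norm_num)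
    haveI : Subsingleton {g : G // g ^ 2 = 1} := (Nat.card_eq_one_iff_unique.mp h1).1
    exact hg1 (congrArg Subtype.val
      (Subsingleton.elim (⟨g, hg2⟩ : {g : G // g ^ 2 = 1}) ⟨1, one_pow 2⟩))
  · intro hodd
    have hdvd : Nat.card {g : G // g ^ 2 = 1} ∣ Nat.card G := by
      rw [← Nat.card_congr (Equiv.subtypeEquivRight (fun g : G => by
          rw [MonoidHom.mem_ker, powMonoidHom_apply]) :
          ((powMonoidHom 2 : G →* G).ker) ≃ {g : G // g ^ 2 = 1})]
      exact Subgroup.card_subgroup_dvd_card _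
    haveI : Fact (Nat.Prime 2) := ⟨Nat.prime_two⟩
    have hP : IsPGroup 2 (powMonoidHom 2 : G →* G).ker := fun g => ⟨1, Subtype.ext (by
      have hg := g.2
      rw [MonoidHom.mem_ker, powMonoidHom_apply] at hg
      rw [pow_one, Subgroup.coe_pow, Subgroup.coe_one, hg])⟩
    obtain ⟨k, hk⟩ := IsPGroup.iff_card.mp hP
    have hk' : Nat.card {g : G // g ^ 2 = 1} = 2 ^ k := by
      rw [← hk]
      exact Nat.card_congr (Equiv.subtypeEquivRight fun g => by rw [MonoidHom.mem_ker, powMonoidHom_apply])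
    rw [hk'] at hdvd ⊢
    exact Nat.Coprime.eq_one_of_dvd (Nat.Coprime.pow_left k hodd.coprime_two_left) hdvd

/-- **Louboutin–Okazaki §2 (4), first statement: a non-normal quartic CM field with odd relative class number has
exactly one finite prime of `K⁺` ramified in `K`** (`t ≤ 1` by Prop. 2, `t ≥ 1` by §2 (1)).
[cite: LouboutinOkazaki1994, §2 (4)] -/
theorem IsCMField.card_ramified_eq_one_of_not_isGalois_of_odd (h4 : finrank ℚ K = 4) (hK : ¬ IsGalois ℚ K)
    (hodd : Odd (classNumber K / classNumber (maximalRealSubfield K))) :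
    {v : HeightOneSpectrum (𝓞 (maximalRealSubfield K)) | v.asIdeal.ramificationIdxIn (𝓞 K) ≠ 1}.ncard = 1 := by
  have hle := IsCMField.card_ramified_le_one_of_odd_classNumber_div K hodd
  obtain ⟨v, hv⟩ := IsCMField.exists_not_isUnramifiedIn_of_not_isGalois K h4 hK
  have hmem : v ∈ {v : HeightOneSpectrum (𝓞 (maximalRealSubfield K)) | v.asIdeal.ramificationIdxIn (𝓞 K) ≠ 1} :=
    fun h => hv ((IsCMField.ramificationIdxIn_eq_one_iff_isUnramifiedIn K v).1 h)
  have hpos := (Set.ncard_pos (AmbiguousIdeal.finite_setOf_ramificationIdxIn_ne_one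
    (K := maximalRealSubfield K) (L := K))).2 ⟨v, hmem⟩
  omega

/-- The ramified prime: under the same hypotheses there is a finite prime `v₀` of `K⁺` ramified in `K` such that
every other finite prime is unramified. [cite: LouboutinOkazaki1994, §2 (4)] -/
theorem IsCMField.exists_unique_not_isUnramifiedIn_of_not_isGalois_of_odd (h4 : finrank ℚ K = 4)
    (hK : ¬ IsGalois ℚ K) (hodd : Odd (classNumber K / classNumber (maximalRealSubfield K))) :
    ∃ v₀ : HeightOneSpectrum (𝓞 (maximalRealSubfield K)), ¬ Algebra.IsUnramifiedIn (𝓞 K) v₀.asIdeal ∧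
      ∀ v : HeightOneSpectrum (𝓞 (maximalRealSubfield K)), v ≠ v₀ → Algebra.IsUnramifiedIn (𝓞 K) v.asIdeal := by
  obtain ⟨v₀, hv₀⟩ := Set.ncard_eq_one.1 (IsCMField.card_ramified_eq_one_of_not_isGalois_of_odd K h4 hK hodd)
  refine ⟨v₀, fun h => ?_, fun v hv => ?_⟩
  · have hmem : v₀ ∈ ({v₀} : Set (HeightOneSpectrum (𝓞 (maximalRealSubfield K)))) := Set.mem_singleton v₀
    rw [← hv₀] at hmem
    exact hmem ((IsCMField.ramificationIdxIn_eq_one_iff_isUnramifiedIn K v₀).2 h)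
  · by_contra hunr
    have hmem : v ∈ {v : HeightOneSpectrum (𝓞 (maximalRealSubfield K)) | v.asIdeal.ramificationIdxIn (𝓞 K) ≠ 1} :=
      fun h => hunr ((IsCMField.ramificationIdxIn_eq_one_iff_isUnramifiedIn K v).1 h)
    rw [hv₀, Set.mem_singleton_iff] at hmem
    exact hv hmem

/-- **«By [W, Th. 10.2], the class number `h(K⁺)` of the real quadratic subfield is odd»** for a non-normal quartic
CM field with `h⁻_K` odd: `#Cl_{K⁺}[2] ∣ κ_K · #A_K[2]` (Washington Prop. 10.12, tree) with `κ_K = 1` (§2 (2)) and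
`#A_K[2] = 1` (`h⁻_K = #A_K` odd). [cite: LouboutinOkazaki1994, §2 (3) (first paragraph)] [cite: Washington1997, Thm. 10.2] -/
theorem IsCMField.odd_classNumber_maximalRealSubfield_of_not_isGalois_of_odd (h4 : finrank ℚ K = 4)
    (hK : ¬ IsGalois ℚ K) (hodd : Odd (classNumber K / classNumber (maximalRealSubfield K))) :
    Odd (classNumber (maximalRealSubfield K)) := by
  classical
  have hκ : Nat.card (classGroupExtend (maximalRealSubfield K) K).ker = 1 := by
    rw [(MonoidHom.ker_eq_bot_iff _).mpr (IsCMField.classGroupExtend_injective_of_not_isGalois K h4 hK),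
      Subgroup.card_bot]
  have h := IsCMField.card_twoTorsion_classGroup_maximalRealSubfield_dvd K
  rw [hκ, IsCMField.card_twoTorsion_ker_eq_one_of_odd K hodd, mul_one, Nat.dvd_one] at h
  have hodd' := (card_twoTorsion_eq_one_iff_odd_card'.1 h)
  rwa [Nat.card_eq_fintype_card] at hodd'

/-- **`h(K)` is odd** for a non-normal quartic CM field with `h⁻_K` odd (`h(K) = h⁻_K · h(K⁺)`).
[cite: LouboutinOkazaki1994, §2 (3)] -/
theorem IsCMField.odd_classNumber_of_not_isGalois_of_odd (h4 : finrank ℚ K = 4) (hK : ¬ IsGalois ℚ K)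
    (hodd : Odd (classNumber K / classNumber (maximalRealSubfield K))) : Odd (classNumber K) := by
  have h := IsCMField.card_ker_classGroupNorm_mul_card K
  rw [← IsCMField.classNumber_div_eq_card_ker] at h
  change classNumber K / classNumber (maximalRealSubfield K) * classNumber (maximalRealSubfield K) =
    classNumber K at h
  rw [← h]
  exact hodd.mul (IsCMField.odd_classNumber_maximalRealSubfield_of_not_isGalois_of_odd K h4 hK hodd)

/-- `#Cl_K[2] = 1` for a non-normal quartic CM field with `h⁻_K` odd. [cite: LouboutinOkazaki1994, §2 (3)] -/
theorem IsCMField.card_twoTorsion_classGroup_eq_one_of_not_isGalois_of_odd (h4 : finrank ℚ K = 4)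
    (hK : ¬ IsGalois ℚ K) (hodd : Odd (classNumber K / classNumber (maximalRealSubfield K))) :
    Nat.card {c : ClassGroup (𝓞 K) // c ^ 2 = 1} = 1 := by
  classical
  refine card_twoTorsion_eq_one_iff_odd_card'.2 ?_
  rw [Nat.card_eq_fintype_card]
  exact IsCMField.odd_classNumber_of_not_isGalois_of_odd K h4 hK hodd

/-- **Every totally positive unit of `K⁺` is a square of a unit**, `#(E⁺_{K⁺}/E²_{K⁺}) = 1`, for a non-normal
quartic CM field with `h⁻_K` odd: Horie's Lemma 1 (ii) at `t = 1` gives `#Cl_K[2] = #(E⁺/E²)`, and `#Cl_K[2] = 1`.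
[cite: LouboutinOkazaki1994, §2 (3)] [cite: Horie1994, §1 Lemma 1 (ii)] -/
theorem IsCMField.card_totPosUnitsModSq_eq_one_of_not_isGalois_of_odd (h4 : finrank ℚ K = 4)
    (hK : ¬ IsGalois ℚ K) (hodd : Odd (classNumber K / classNumber (maximalRealSubfield K))) :
    Nat.card (TotPosUnitsModSq (maximalRealSubfield K)) = 1 := by
  obtain ⟨v₀, hv₀, hunr⟩ := IsCMField.exists_unique_not_isUnramifiedIn_of_not_isGalois_of_odd K h4 hK hodd
  have h := (IsCMField.card_twoTorsion_classGroup_eq_card_totPosUnitsModSq_of_odd_of_isUnramifiedIn K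
    (IsCMField.odd_classNumber_maximalRealSubfield_of_not_isGalois_of_odd K h4 hK hodd) hv₀ hunr).1
  rw [← h, IsCMField.card_twoTorsion_classGroup_eq_one_of_not_isGalois_of_odd K h4 hK hodd]

/-- **`h⁺(K⁺) = h(K⁺)`** for a non-normal quartic CM field with `h⁻_K` odd (`h⁺ = h · #(E⁺/E²)`).
[cite: LouboutinOkazaki1994, §2 (3)–(4) (proof of (4): «h(K⁺) = h⁺»)] -/
theorem IsCMField.narrowClassNumber_eq_classNumber_of_not_isGalois_of_odd (h4 : finrank ℚ K = 4)
    (hK : ¬ IsGalois ℚ K) (hodd : Odd (classNumber K / classNumber (maximalRealSubfield K))) :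
    narrowClassNumber (maximalRealSubfield K) = classNumber (maximalRealSubfield K) := by
  rw [narrowClassNumber_eq_classNumber_mul_card_totPosUnitsModSq,
    IsCMField.card_totPosUnitsModSq_eq_one_of_not_isGalois_of_odd K h4 hK hodd, mul_one]

/-- **Louboutin–Okazaki §2 (3): the strict class number `h⁺(K⁺)` of the real quadratic subfield of a non-normal
quartic CM field with odd relative class number is odd** — here WITHOUT class field theory (Chevalley's formula
and Hasse's norm theorem instead of the class field of `H⁺(K⁺)²`). [cite: LouboutinOkazaki1994, §2 (3)] -/
theorem IsCMField.odd_narrowClassNumber_of_not_isGalois_of_odd (h4 : finrank ℚ K = 4) (hK : ¬ IsGalois ℚ K)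
    (hodd : Odd (classNumber K / classNumber (maximalRealSubfield K))) :
    Odd (narrowClassNumber (maximalRealSubfield K)) := by
  rw [IsCMField.narrowClassNumber_eq_classNumber_of_not_isGalois_of_odd K h4 hK hodd]
  exact IsCMField.odd_classNumber_maximalRealSubfield_of_not_isGalois_of_odd K h4 hK hodd

/-! ### (3), second sentence: `K⁺ = ℚ(√p)` with `p ≢ 3 (mod 4)` a prime -/

/-- **`d_{K⁺} = 8` or `d_{K⁺} = p ≡ 1 (mod 4)` prime** for the real quadratic subfield of a non-normal quartic CM field with
odd relative class number (`h⁺(K⁺)` odd, and a real quadratic field has odd strict class number iff its discriminant is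
`8` or a prime `≡ 1 (mod 4)`, `Quadratic.odd_narrowClassNumber_iff_discr_eq`).
[cite: LouboutinOkazaki1994, §2 (3) («Thus K⁺ = ℚ(√p) with p ≢ 3 (mod 4) a prime»)] [cite: FrohlichTaylor1990, Ch. V §1 Thm. 39 Cor. 2, p. 164] -/
theorem IsCMField.discr_maximalRealSubfield_eq_of_not_isGalois_of_odd (h4 : finrank ℚ K = 4) (hK : ¬ IsGalois ℚ K)
    (hodd : Odd (classNumber K / classNumber (maximalRealSubfield K))) :
    NumberField.discr (maximalRealSubfield K) = 8 ∨
      (Prime (NumberField.discr (maximalRealSubfield K)) ∧ NumberField.discr (maximalRealSubfield K) % 4 = 1) :=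
  (_root_.Literature.NumberTheory.QuadraticFields.Quadratic.odd_narrowClassNumber_iff_discr_eq
    (IsCMField.finrank_maximalRealSubfield_eq_two_of_finrank_eq_four K h4)).mp
    (IsCMField.odd_narrowClassNumber_of_not_isGalois_of_odd K h4 hK hodd)

/-- **Louboutin–Okazaki §2 (3), second sentence: «Thus `K⁺ = ℚ(√p)` with `p ≢ 3 (mod 4)` a prime»** — for a non-normal
quartic CM field `K` with odd relative class number there is a prime `p`, `p = 2` or `p ≡ 1 (mod 4)`, and an element
`x ∈ K⁺ ∖ ℚ` with `x² = p` (so `K⁺ = ℚ(x) = ℚ(√p)`, `[K⁺ : ℚ] = 2`).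
[cite: LouboutinOkazaki1994, §2 (3)] [cite: FrohlichTaylor1990, Ch. V §1 Thm. 39 Cor. 2, p. 164] -/
theorem IsCMField.exists_prime_sq_eq_of_not_isGalois_of_odd (h4 : finrank ℚ K = 4) (hK : ¬ IsGalois ℚ K)
    (hodd : Odd (classNumber K / classNumber (maximalRealSubfield K))) :
    ∃ p : ℕ, p.Prime ∧ (p = 2 ∨ p % 4 = 1) ∧
      ∃ x : maximalRealSubfield K, x ^ 2 = (p : maximalRealSubfield K) ∧
        x ∉ Set.range (algebraMap ℚ (maximalRealSubfield K)) :=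
  _root_.Literature.NumberTheory.QuadraticFields.Quadratic.exists_prime_sq_eq_of_odd_narrowClassNumber
    (IsCMField.finrank_maximalRealSubfield_eq_two_of_finrank_eq_four K h4)
    (IsCMField.odd_narrowClassNumber_of_not_isGalois_of_odd K h4 hK hodd)


/-! ### The converse ((8) and Theorem 4, intrinsic form): `h⁻_K` odd ⟺ `h_K` odd ⟺ `h⁺(K⁺)` odd and `t = 1` -/

/-- **`h_K` odd ⟹ `h⁻_K` odd**, for every CM field (`h_K = h⁻_K · h_{K⁺}`).
[cite: LouboutinOkazaki1994, §2 (8) (proof, last sentence: «there does not exist an ideal class of order 2, so that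
h(K) is odd», whence h*(K) is odd)] -/
theorem IsCMField.odd_classNumber_div_of_odd_classNumber (hodd : Odd (classNumber K)) :
    Odd (classNumber K / classNumber (maximalRealSubfield K)) := by
  have h := IsCMField.card_ker_classGroupNorm_mul_card K
  rw [← IsCMField.classNumber_div_eq_card_ker] at h
  change classNumber K / classNumber (maximalRealSubfield K) * classNumber (maximalRealSubfield K) =
    classNumber K at h
  rw [← h] at hodd
  exact (Nat.odd_mul.mp hodd).1

/-- **`h⁺(K⁺)` odd and exactly one finite prime of `K⁺` ramified in `K` ⟹ `h_K` and `h⁻_K` are odd**, for every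
CM field `K` (Chevalley's formula: `rank₂ C_K = t − 1` when `h⁺(K⁺)` is odd, `CMFieldAmbiguousClassNumber.lean`) —
the mechanism of Louboutin–Okazaki's (8) («let C be an ideal class of order ≤ 2 … C is an ambiguous class … the
order of C is odd»). [cite: LouboutinOkazaki1994, §2 (8) (proof)] [cite: Okazaki2000, §3 Lemma 17] -/
theorem IsCMField.odd_classNumber_div_of_odd_narrowClassNumber_of_ncard_eq_one
    (hodd : Odd (narrowClassNumber (maximalRealSubfield K)))
    (ht : {v : HeightOneSpectrum (𝓞 (maximalRealSubfield K)) | v.asIdeal.ramificationIdxIn (𝓞 K) ≠ 1}.ncard = 1) :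
    Odd (classNumber K) ∧ Odd (classNumber K / classNumber (maximalRealSubfield K)) := by
  have h := (IsCMField.odd_classNumber_iff_of_odd_narrowClassNumber K hodd).mpr ht
  exact ⟨h, IsCMField.odd_classNumber_div_of_odd_classNumber K h⟩

/-- **For a non-normal quartic CM field: `h⁻_K` is odd iff `h_K` is odd** (⟹: `h(K⁺)` is odd too, (3); ⟸: `h⁻_K ∣ h_K`).
[cite: LouboutinOkazaki1994, §2 (3) and (8)] -/
theorem IsCMField.odd_classNumber_div_iff_odd_classNumber_of_not_isGalois (h4 : finrank ℚ K = 4)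
    (hK : ¬ IsGalois ℚ K) :
    Odd (classNumber K / classNumber (maximalRealSubfield K)) ↔ Odd (classNumber K) :=
  ⟨IsCMField.odd_classNumber_of_not_isGalois_of_odd K h4 hK, IsCMField.odd_classNumber_div_of_odd_classNumber K⟩

/-- **Louboutin–Okazaki's characterisation, intrinsic form (§2 (3)–(4) with (8); Theorem 4): a non-normal quartic CM
field `K` has odd relative class number iff the strict class number of `K⁺` is odd and exactly one finite prime of
`K⁺` ramifies in `K`** (⟹ is (3)–(4); ⟸ is the argument of (8): every class of order `≤ 2` is ambiguous and the
ambiguous classes number `h(K⁺)`, odd).  Theorem 4 as printed («a number field is a non-normal quartic CM-field with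
odd relative class number if and only if it is a subfield of a dihedral octic CM-field N(p,q) …») and (6)–(7) (the
fields `N(p,q)`) are NOT typed. [cite: LouboutinOkazaki1994, §2 (3), (4), (8) and Theorem 4] -/
theorem IsCMField.odd_classNumber_div_iff_of_not_isGalois (h4 : finrank ℚ K = 4) (hK : ¬ IsGalois ℚ K) :
    Odd (classNumber K / classNumber (maximalRealSubfield K)) ↔
      Odd (narrowClassNumber (maximalRealSubfield K)) ∧
        {v : HeightOneSpectrum (𝓞 (maximalRealSubfield K)) | v.asIdeal.ramificationIdxIn (𝓞 K) ≠ 1}.ncard = 1 :=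
  ⟨fun hodd => ⟨IsCMField.odd_narrowClassNumber_of_not_isGalois_of_odd K h4 hK hodd,
    IsCMField.card_ramified_eq_one_of_not_isGalois_of_odd K h4 hK hodd⟩,
    fun h => (IsCMField.odd_classNumber_div_of_odd_narrowClassNumber_of_ncard_eq_one K h.1 h.2).2⟩

/-- The same with the ramification condition in the `IsUnramifiedIn` form: **`h⁻_K` odd ⟺ `h⁺(K⁺)` odd and there is
a finite prime `v₀` of `K⁺` ramified in `K` with every other finite prime unramified.**
[cite: LouboutinOkazaki1994, §2 (3), (4), (8) and Theorem 4] -/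
theorem IsCMField.odd_classNumber_div_iff_exists_unique_of_not_isGalois (h4 : finrank ℚ K = 4) (hK : ¬ IsGalois ℚ K) :
    Odd (classNumber K / classNumber (maximalRealSubfield K)) ↔
      Odd (narrowClassNumber (maximalRealSubfield K)) ∧
        ∃ v₀ : HeightOneSpectrum (𝓞 (maximalRealSubfield K)), ¬ Algebra.IsUnramifiedIn (𝓞 K) v₀.asIdeal ∧
          ∀ v : HeightOneSpectrum (𝓞 (maximalRealSubfield K)), v ≠ v₀ → Algebra.IsUnramifiedIn (𝓞 K) v.asIdeal := by
  constructor
  · intro hodd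
    exact ⟨IsCMField.odd_narrowClassNumber_of_not_isGalois_of_odd K h4 hK hodd,
      IsCMField.exists_unique_not_isUnramifiedIn_of_not_isGalois_of_odd K h4 hK hodd⟩
  · rintro ⟨hodd, v₀, hv₀, hunr⟩
    refine (IsCMField.odd_classNumber_div_of_odd_narrowClassNumber_of_ncard_eq_one K hodd ?_).2
    exact IsCMField.card_ramified_eq_one_of_isUnramifiedIn K hv₀ hunr

end Literature.NumberTheory.NumberFields

end
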